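import Summits.ValiantsHypothesis.ValiantsHypothesis.Theses.ValuativeGCT

/-!
# `ValuativeGCT.CoeffVanishingOrder` (support stmt-ValiantsHypothesis-12628) — the valuative estimate

`CoeffVanishingOrder_proof : Theses.ValuativeGCT.CoeffVanishingOrder`: if every matrix of the linear space
`U ≤ (MatIdx m → ℂ)` has rank `≤ r` (as an `m × m` matrix via `toLex`), then every coefficient (in `x`) of
`det_m(x · A)` — a polynomial in the entries `A (j, i)` of `A ∈ End(ℂ^{MatIdx m})` — lies in the `(m - r)`-th
power of the vanishing ideal `𝔭` of `L_U = {A | every row (i ↦ A (j, i)) lies in U}`.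

Proof (projection-mixed-columns line; def-free port of the candidate `TriageR1K3.CVO` of
`Cruxes/ValuativeBound/TRIAGE-r1-3-ValuativeBoundProof.lean`, Part II):
* `det_m(x · A) = det N(x)` with `N(x)_{ab} = Σ_j A(j,(a,b)) · x_j` (`linSubst` is the COLUMN convention
  `X i ↦ Σ_j A j i • X j`, so `x_j` multiplies row `j` of `A`) — `linSubst_generic_detFormLex`;
* choose a projection `P` onto `U` (`Submodule.exists_isCompl`) and split `N = N_U + N_C`, where `N_U` pushes every
  row of `A` through `P` and `N_C` through `1 - P`; the entries of `N_C` have `A`-coefficients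
  `A(j,ab) - Σ_k P ab k · A(j,k) ∈ 𝔭` (they vanish when every row of `A` lies in `U = Fix P`);
* column expansion `det (N_U + N_C) = Σ_T det (mix_T)` (`det_add_eq_sum_det_mix`, Leibniz + `Finset.prod_add`);
* a mixed determinant with `|T| > r` columns from `N_U` vanishes identically (`det_mixU_eq_zero`: by a double
  `MvPolynomial.funext` its `T`-columns specialise to columns of the matrix of `P w ∈ U`, of rank `≤ r < |T|`,
  `det_mixCols_eq_zero_of_rank_lt`);
* one with `|T| ≤ r` has `≥ m - r` columns with entries in `𝔭 · S`, hence lies in `(𝔭 · S)^(m-r) = (𝔭^(m-r)) · S`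
  (`det_mem_pow_of_cols_mem`), and `MvPolynomial.mem_map_C_iff` extracts the coefficient.
Elementary multilinear algebra. [folklore]
-/

namespace Summit.ValiantsHypothesis.ValiantsHypothesis.Theorems.CoeffVanishingOrder

open Literature.NumberTheory.DiophantineGeometry Literature.Computability.AlgebraicComplexity
open MvPolynomial
open scoped BigOperators Matrix

-- `Summit.ValiantsHypothesis.ValiantsHypothesis.…` is the tree's mandated single-conjunct layout (Sub = Summit).
set_option linter.dupNamespace false

noncomputable section

/-! ## §1 Column expansion of `det (A + B)` over column subsets -/

/-- `det (A + B) = Σ_T det (mix_T)`, where `mix_T` takes column `b` from `A` if `b ∈ T` and from `B` otherwise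
(multilinearity of the determinant in the columns: Leibniz formula + `Finset.prod_add`). [folklore] -/
theorem det_add_eq_sum_det_mix {n : Type*} [Fintype n] [DecidableEq n] {R : Type*} [CommRing R]
    (A B : Matrix n n R) :
    (A + B).det = ∑ T ∈ (Finset.univ : Finset n).powerset,
      (Matrix.of fun a b => if b ∈ T then A a b else B a b).det := by
  simp only [Matrix.det_apply', Matrix.add_apply, Matrix.of_apply]
  have h1 : ∀ τ : Equiv.Perm n, ∏ i, (A (τ i) i + B (τ i) i) =
      ∑ T ∈ (Finset.univ : Finset n).powerset,
        (∏ i ∈ T, A (τ i) i) * ∏ i ∈ Finset.univ \ T, B (τ i) i :=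
    fun τ => Finset.prod_add _ _ _
  have h2 : ∀ (τ : Equiv.Perm n) (T : Finset n),
      ∏ i, (if i ∈ T then A (τ i) i else B (τ i) i) =
        (∏ i ∈ T, A (τ i) i) * ∏ i ∈ Finset.univ \ T, B (τ i) i := by
    intro τ T
    rw [Finset.prod_ite]
    congr 2
    · ext i; simp
    · ext i; simp [Finset.mem_sdiff]
  simp_rw [h1, h2, Finset.mul_sum]
  exact Finset.sum_comm

/-! ## §2 Mixed column determinants -/

/-- If `rank Mu ≤ r < |T|` then the matrix taking its `T`-columns from `Mu` (and the other columns from an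
arbitrary `W`) is singular: the `T`-columns of `Mu` are linearly dependent, and a dependence supported on `T`
is a kernel vector of the mixed matrix. [folklore] -/
theorem det_mixCols_eq_zero_of_rank_lt {m r : ℕ} (Mu : Matrix (Fin m) (Fin m) ℂ) (hMu : Mu.rank ≤ r)
    (T : Finset (Fin m)) (hT : r < T.card) (W : Matrix (Fin m) (Fin m) ℂ) :
    (Matrix.of fun a b => if b ∈ T then Mu a b else W a b).det = 0 := by
  classical
  set g : T → (Fin m → ℂ) := fun b a => Mu a b with hg
  have hdep : ¬ LinearIndependent ℂ g := by
    intro hli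
    set M : Submodule ℂ (Fin m → ℂ) := Submodule.span ℂ (Set.range Mu.col) with hM
    have hmem : ∀ b : T, g b ∈ M := fun b => Submodule.subset_span ⟨b, rfl⟩
    have hli' : LinearIndependent ℂ (fun b : T => (⟨g b, hmem b⟩ : M)) := by
      apply LinearIndependent.of_comp M.subtype
      exact hli
    have hcard := hli'.fintype_card_le_finrank
    rw [Fintype.card_coe, hM, ← Matrix.rank_eq_finrank_span_cols] at hcard
    omega
  obtain ⟨c, hc0, b₀, hb₀⟩ := Fintype.not_linearIndependent_iff.mp hdep
  let v : Fin m → ℂ := fun b => if h : b ∈ T then c ⟨b, h⟩ else 0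
  have hv : v ≠ 0 := by
    intro h
    apply hb₀
    have hb := congr_fun h b₀
    simp only [v, Pi.zero_apply] at hb
    rw [dif_pos b₀.2] at hb
    exact hb
  apply Matrix.exists_mulVec_eq_zero_iff.mp
  refine ⟨v, hv, ?_⟩
  funext a
  have ha := congr_fun hc0 a
  simp only [Finset.sum_apply, Pi.smul_apply, smul_eq_mul, Pi.zero_apply] at ha
  rw [Matrix.mulVec, Pi.zero_apply]
  change ∑ b, (if b ∈ T then Mu a b else W a b) * v b = 0
  have hsub : ∑ b, (if b ∈ T then Mu a b else W a b) * v b =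
      ∑ b ∈ T, (if b ∈ T then Mu a b else W a b) * v b := by
    symm
    apply Finset.sum_subset (Finset.subset_univ T)
    intro b _ hb
    simp only [v, dif_neg hb, mul_zero]
  rw [hsub, ← Finset.sum_coe_sort]
  rw [← ha]
  refine Finset.sum_congr rfl fun b _ => ?_
  simp only [v, if_pos b.2, dif_pos b.2, hg]
  ring

/-- If every entry of `M` outside the columns `T` lies in the ideal `I`, then `det M ∈ I ^ |Tᶜ|` (each Leibniz
term has `|Tᶜ|` factors from `I`). [folklore] -/
theorem det_mem_pow_of_cols_mem {n : Type*} [Fintype n] [DecidableEq n] {R : Type*} [CommRing R]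
    (I : Ideal R) (M : Matrix n n R) (T : Finset n) (hM : ∀ a, ∀ b ∉ T, M a b ∈ I) :
    M.det ∈ I ^ Tᶜ.card := by
  rw [Matrix.det_apply']
  refine Ideal.sum_mem _ fun τ _ => Ideal.mul_mem_left _ _ ?_
  rw [← Finset.prod_mul_prod_compl T]
  refine Ideal.mul_mem_left _ _ ?_
  rw [← Finset.prod_const]
  exact Ideal.prod_mem_prod fun i hi => hM _ _ (Finset.mem_compl.mp hi)

/-! ## §3 The generic matrix of forms -/

/-- `det_m(x · A) = det N(x)`: the generic substitution of the item (`linSubst` by the generic matrix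
`(j, i) ↦ A_(j,i)`, column convention `X i ↦ Σ_j A j i • X j`) applied to `det_m` is the determinant of the generic
matrix of linear forms `N(x)_{ab} = Σ_j A(j,(a,b)) · x_j`. [folklore] -/
theorem linSubst_generic_detFormLex (m : ℕ) :
    linSubst (MatIdx m) (MvPolynomial (MatIdx m × MatIdx m) ℂ) (Matrix.of fun j i : MatIdx m => X (j, i))
        (map C (detFormLex ℂ m)) =
      (Matrix.of fun a b : Fin m => ∑ j : MatIdx m,
        C (X (j, toLex (a, b)) : MvPolynomial (MatIdx m × MatIdx m) ℂ) * X j).det := by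
  rw [detFormLex, detPoly, AlgHom.map_det, RingHom.map_det, AlgHom.map_det]
  congr 1
  ext a b
  simp [Matrix.map_apply, rename_X, map_X, Literature.Computability.AlgebraicComplexity.linSubst_X, smul_eq_C_mul]

/-- Mixed determinants with more than `r` columns from the `U`-part VANISH identically: for a matrix `P` with
`P w ∈ U` for all `w`, if the `T`-columns (`|T| > r`) of a matrix of polynomials have entries
`Σ_j C(Σ_k P (a,b) k · A(j,k)) · x_j`, its determinant is `0` — at every point `(x, A)` these columns are columns
of the matrix of `P (Σ_j x_j · row_j A) ∈ U`, of rank `≤ r` (double `MvPolynomial.funext`). [folklore] -/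
theorem det_mixU_eq_zero {m r : ℕ} (U : Submodule ℂ (MatIdx m → ℂ))
    (hU : ∀ u ∈ U, (Matrix.of fun a b : Fin m => u (toLex (a, b))).rank ≤ r)
    (P : Matrix (MatIdx m) (MatIdx m) ℂ) (hP : ∀ w : MatIdx m → ℂ, P *ᵥ w ∈ U)
    (NU W : Matrix (Fin m) (Fin m) (MvPolynomial (MatIdx m) (MvPolynomial (MatIdx m × MatIdx m) ℂ)))
    (hNU : ∀ a b, NU a b = ∑ j : MatIdx m,
      C (∑ k : MatIdx m, P (toLex (a, b)) k • X (j, k) : MvPolynomial (MatIdx m × MatIdx m) ℂ) * X j)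
    (T : Finset (Fin m)) (hT : r < T.card) :
    (Matrix.of fun a b => if b ∈ T then NU a b else W a b).det = 0 := by
  classical
  apply MvPolynomial.funext
  intro y
  rw [map_zero, RingHom.map_det]
  apply MvPolynomial.funext
  intro A₀
  rw [map_zero, RingHom.map_det]
  have hentry : ∀ a b : Fin m, eval A₀ (eval y (NU a b)) =
      (P *ᵥ fun k => ∑ j : MatIdx m, eval A₀ (y j) * A₀ (j, k)) (toLex (a, b)) := by
    intro a b
    rw [hNU]
    simp only [map_sum, map_mul, eval_C, eval_X, smul_eval, Matrix.mulVec, dotProduct, Finset.mul_sum,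
      Finset.sum_mul]
    rw [Finset.sum_comm]
    refine Finset.sum_congr rfl fun k _ => Finset.sum_congr rfl fun j _ => ?_
    ring
  have hmat : (eval A₀).mapMatrix ((eval y).mapMatrix (Matrix.of fun a b => if b ∈ T then NU a b else W a b)) =
      Matrix.of fun a b => if b ∈ T then
        (Matrix.of fun a b : Fin m =>
          (P *ᵥ fun k => ∑ j : MatIdx m, eval A₀ (y j) * A₀ (j, k)) (toLex (a, b))) a b
        else eval A₀ (eval y (W a b)) := by
    ext a b
    simp only [RingHom.mapMatrix_apply, Matrix.map_apply, Matrix.of_apply]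
    split_ifs with hb
    · exact hentry a b
    · rfl
  rw [hmat]
  exact det_mixCols_eq_zero_of_rank_lt _ (hU _ (hP _)) T hT _

/-! ## §4 The item -/

/-- **stmt-ValiantsHypothesis-12628** (`ValuativeGCT.CoeffVanishingOrder`, the valuative estimate): if every matrix
of `U` has rank `≤ r`, every coefficient of `det_m(x · A)` (as a polynomial in the entries of `A`) lies in the
`(m - r)`-th power of the vanishing ideal of `L_U = {A : every row of A lies in U}`. [folklore] -/
theorem CoeffVanishingOrder_proof : Theses.ValuativeGCT.CoeffVanishingOrder := by
  intro m U r hU d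
  classical
  -- the ideal of `L_U`
  set 𝔭 : Ideal (MvPolynomial (MatIdx m × MatIdx m) ℂ) := MvPolynomial.vanishingIdeal ℂ
    {p : MatIdx m × MatIdx m → ℂ | ∀ j : MatIdx m, (fun i => p (j, i)) ∈ U} with h𝔭
  -- a projection `P` onto `U`
  obtain ⟨V, hUV⟩ := U.exists_isCompl
  set P : Matrix (MatIdx m) (MatIdx m) ℂ := LinearMap.toMatrix' (U.projection V hUV) with hPdef
  have hPmul : ∀ w, P *ᵥ w = U.projection V hUV w := fun w => by
    rw [hPdef, ← Matrix.toLin'_apply, Matrix.toLin'_toMatrix']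
  have hP : ∀ w, P *ᵥ w ∈ U := fun w => by
    rw [hPmul]
    exact Submodule.projection_apply_mem hUV w
  have hPid : ∀ u ∈ U, P *ᵥ u = u := fun u hu => by
    rw [hPmul]
    exact Submodule.projection_apply_left hUV ⟨u, hu⟩
  -- the complementary coefficients `A(j,ab) - Σ_k P ab k · A(j,k)` vanish on `L_U`
  have huC : ∀ j ab : MatIdx m,
      (X (j, ab) - ∑ k : MatIdx m, P ab k • X (j, k) : MvPolynomial (MatIdx m × MatIdx m) ℂ) ∈ 𝔭 := by
    intro j ab
    rw [h𝔭, MvPolynomial.mem_vanishingIdeal_iff]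
    intro p hp
    have hrow : P *ᵥ (fun i => p (j, i)) = fun i => p (j, i) := hPid _ (hp j)
    have h := congr_fun hrow ab
    simp only [Matrix.mulVec, dotProduct] at h
    simp only [map_sub, map_sum, map_smul, aeval_X, smul_eq_mul]
    rw [h, sub_self]
  -- `N = N_U + N_C`
  set NU : Matrix (Fin m) (Fin m) (MvPolynomial (MatIdx m) (MvPolynomial (MatIdx m × MatIdx m) ℂ)) :=
    Matrix.of fun a b : Fin m => ∑ j : MatIdx m,
      C (∑ k : MatIdx m, P (toLex (a, b)) k • X (j, k) : MvPolynomial (MatIdx m × MatIdx m) ℂ) * X j with hNU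
  set NC : Matrix (Fin m) (Fin m) (MvPolynomial (MatIdx m) (MvPolynomial (MatIdx m × MatIdx m) ℂ)) :=
    Matrix.of fun a b : Fin m => ∑ j : MatIdx m,
      C (X (j, toLex (a, b)) - ∑ k : MatIdx m, P (toLex (a, b)) k • X (j, k) :
        MvPolynomial (MatIdx m × MatIdx m) ℂ) * X j with hNC
  have hN : (Matrix.of fun a b : Fin m => ∑ j : MatIdx m,
      C (X (j, toLex (a, b)) : MvPolynomial (MatIdx m × MatIdx m) ℂ) * X j) = NU + NC := by
    ext a b
    simp only [hNU, hNC, Matrix.add_apply, Matrix.of_apply, map_sub, sub_mul, Finset.sum_sub_distrib]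
    ring
  -- the determinant lies in `𝔭^(m-r) · S`
  have hdet : linSubst (MatIdx m) (MvPolynomial (MatIdx m × MatIdx m) ℂ) (Matrix.of fun j i : MatIdx m => X (j, i))
      (map C (detFormLex ℂ m)) ∈
      Ideal.map (C : MvPolynomial (MatIdx m × MatIdx m) ℂ →+*
        MvPolynomial (MatIdx m) (MvPolynomial (MatIdx m × MatIdx m) ℂ)) (𝔭 ^ (m - r)) := by
    rw [linSubst_generic_detFormLex, hN, det_add_eq_sum_det_mix, Ideal.map_pow]
    refine Ideal.sum_mem _ fun T _ => ?_
    by_cases hT : r < T.card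
    · rw [det_mixU_eq_zero U hU P hP NU NC (fun a b => by rw [hNU]; rfl) T hT]
      exact Ideal.zero_mem _
    · have hle : m - r ≤ Tᶜ.card := by
        rw [Finset.card_compl, Fintype.card_fin]
        omega
      refine Ideal.pow_le_pow_right hle (det_mem_pow_of_cols_mem _ _ T fun a b hb => ?_)
      rw [Matrix.of_apply, if_neg hb, hNC, Matrix.of_apply]
      exact Ideal.sum_mem _ fun j _ => Ideal.mul_mem_right _ _ (Ideal.mem_map_of_mem _ (huC j _))
  rw [aeval_X]
  exact (mem_map_C_iff.mp hdet) d.1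

end

end Summit.ValiantsHypothesis.ValiantsHypothesis.Theorems.CoeffVanishingOrder
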